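import Summits.RiemannHypothesis.RiemannHypothesis.Theorems.UniversalFactorLehmerDefs
import Literature.NumberTheory.LFunctions.DeBruijnHZeroProofs
import Literature.NumberTheory.LFunctions.DeBruijnHDiv

/-!
# RiemannHypothesis / UniversalFactor — `H_0(2t)` near a height `t₀` as the real part of an explicit
analytic multiple of `ζ(½ + it)`

Route `RiemannHypothesis/UniversalFactor`, item `LehmerPointNoGo` (stmt-RiemannHypothesis-2582).
The one-point Laguerre certificate (`UniversalFactorLaguerreCriterion.lean`) needs the signs of
`H_0(x₀)` and of the two one-sided Laplace averages of `H_0` at `x₀ = 2t₀` (`t₀ ≈ 7005.08`, Lehmer's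
pair).  Since `H_0(2t) = ξ(½+it)/8 = −(t²+¼) Λ(½+it)/16` with `Λ = π^{-s/2}Γ(s/2)ζ(s)` real on the
critical line, and `|Γ(¼+it/2)| ≈ e^{−πt/4}` is astronomically small, all three numbers are computed
RELATIVE to the positive constant `K₀ = π^{-1/4}|Γ(¼ + it₀/2)|/16` (`UniversalFactor.lehmerK0`):

* `UniversalFactor.lehmerCore t₀ s = s(1−s) e^{iφ₀} π^{−(s−s₀)/2} e^{F(s/2) − F(s₀/2)} ζ(s)`
  (`s₀ = ½ + it₀`, `F(w) = (w − ½) Log w − w` = `stirlingPrim`, `φ₀` = Stirling's main term of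
  `θ(t₀)`), an explicit holomorphic function on `Re s > 0`, `s ≠ 1`;
* `UniversalFactor.deBruijnH_zero_two_mul_repr` — for `t₀ ≥ 2`, `t > 0`:
  `H_0(2t) · μ = −K₀ · Re lehmerCore t₀ (½ + it)` for some real `μ` with
  `e^{−e} cos(d + e) ≤ μ ≤ e^{e}`, where `d = 2K(¼)/t₀` bounds `|θ(t₀) − φ₀|`
  (`abs_riemannSiegelTheta_sub_stirling_le`) and `e = ε |t − t₀|/2` is the second-order Stirling error
  of `Γ(¼+it/2)/Γ(¼+it₀/2)` along the vertical segment (`Gamma_eq_mul_exp_stirlingPrim`,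
  `norm_digamma_sub_log_add_inv_le`).  At `t₀ ≈ 7005`, `|t − t₀| ≤ 1`: `|μ − 1| ≤ 3·10⁻⁸`.

No numerical datum enters this file.

References: E. C. Titchmarsh, *The Theory of the Riemann Zeta-Function* (1986), §2.1, §4.17, §10.1;
H. M. Edwards, *Riemann's Zeta Function* (1974), §6.5; Whittaker–Watson §12.33 (Stirling / Binet).
-/

noncomputable section

set_option linter.dupNamespace false

namespace Summit.RiemannHypothesis.RiemannHypothesis.Theorems

open Complex Real Set
open Literature.NumberTheory.LFunctions
open Literature.Analysis.SpecialFunctions.Complex (stirlingPrim Gamma_eq_mul_exp_stirlingPrim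
  norm_digamma_sub_log_add_inv_le)

/-! ## The explicit objects -/

/-- `K₀ > 0`. [folklore] -/
theorem UniversalFactor.lehmerK0_pos (t₀ : ℝ) : 0 < UniversalFactor.lehmerK0 t₀ := by
  unfold UniversalFactor.lehmerK0
  have h : 0 < ‖Complex.Gamma (thetaArg t₀)‖ :=
    norm_pos_iff.2 (Complex.Gamma_ne_zero_of_re_pos (thetaArg_re_pos t₀))
  positivity

/-! ## Algebra on the critical line -/

/-- `(½ + it)/2 = ¼ + it/2`. [folklore] -/
theorem UniversalFactor.half_add_div_two (t : ℝ) : ((1 : ℂ) / 2 + t * I) / 2 = thetaArg t := by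
  rw [thetaArg]; ring

/-- `H_0(2t) = −(1/16) s(1−s) Λ(s)`, `s = ½ + it`, from `H_0(z) = ξ(½ + iz/2)/8` and
`ξ(s) = ½ s(s−1) Λ(s)`. [folklore] -/
theorem UniversalFactor.deBruijnH_zero_two_mul (t : ℝ) :
    deBruijnH 0 ((2 * t : ℝ) : ℂ) =
      -(1 / 16) * ((1 / 2 + t * I) * (1 - (1 / 2 + t * I))) * completedRiemannZeta (1 / 2 + t * I) := by
  have hs0 : (1 : ℂ) / 2 + t * I ≠ 0 := fun h => by
    have := congrArg Complex.re h; norm_num at this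
  have hs1 : (1 : ℂ) / 2 + t * I ≠ 1 := fun h => by
    have := congrArg Complex.re h; norm_num at this
  rw [deBruijnH_zero_eq_holds, show (1 : ℂ) / 2 + I * ((2 * t : ℝ) : ℂ) / 2 = 1 / 2 + t * I by
    push_cast; ring, riemannXi_eq_mul_completedRiemannZeta hs0 hs1]
  ring

/-- `Λ(s) = Γ_ℝ(s) ζ(s)` for `s = ½ + it`. [folklore] -/
theorem UniversalFactor.completedRiemannZeta_half (t : ℝ) :
    completedRiemannZeta (1 / 2 + t * I) = Gammaℝ (1 / 2 + t * I) * riemannZeta (1 / 2 + t * I) := by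
  have hs0 : (1 : ℂ) / 2 + t * I ≠ 0 := fun h => by
    have := congrArg Complex.re h; norm_num at this
  have hG : Gammaℝ (1 / 2 + t * I) ≠ 0 := Gammaℝ_ne_zero_of_re_pos (by simp)
  rw [riemannZeta_def_of_ne_zero hs0, mul_div_cancel₀ _ hG]

/-- `G(¼ + it₀/2) = |Γ(¼ + it₀/2)| e^{iθ(t₀)}` (the phase identity). [folklore] -/
theorem UniversalFactor.thetaGamma_eq_norm_mul_cexp (t₀ : ℝ) :
    thetaGamma (thetaArg t₀) =
      (‖Complex.Gamma (thetaArg t₀)‖ : ℂ) * cexp (riemannSiegelTheta t₀ * I) := by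
  have hne : (‖thetaGamma (thetaArg t₀)‖ : ℂ) ≠ 0 := by
    exact_mod_cast (norm_pos_iff.2 (thetaGamma_thetaArg_ne_zero t₀)).ne'
  rw [cexp_theta_mul_I_eq_thetaGamma_div_norm, ← norm_thetaGamma_thetaArg_eq_norm_Gamma,
    mul_div_cancel₀ _ hne]

/-- **Second-order Stirling along the vertical segment**: for `t, t₀ > 0` there is `E` with
`‖E‖ ≤ e(t₀, t)` and `Γ(¼ + it/2) = Γ(¼ + it₀/2) · exp(F(¼+it/2) − F(¼+it₀/2) + E)`. [folklore] -/
theorem UniversalFactor.exists_Gamma_thetaArg_eq {t₀ t : ℝ} (ht₀ : 0 < t₀) (ht : 0 < t) :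
    ∃ E : ℂ, ‖E‖ ≤ UniversalFactor.lehmerSegErr t₀ t ∧
      Complex.Gamma (thetaArg t) = Complex.Gamma (thetaArg t₀) *
        cexp (stirlingPrim (thetaArg t) - stirlingPrim (thetaArg t₀) + E) := by
  set d : ℂ := ((t - t₀) / 2 : ℝ) * I with hd
  have hwd : thetaArg t₀ + d = thetaArg t := by
    simp only [thetaArg, hd]; push_cast; ring
  set b : ℝ := min t t₀ / 2 with hb
  have hb0 : 0 < b := by rw [hb]; exact div_pos (lt_min ht ht₀) two_pos
  set ε : ℝ := 2 * (1 / (6 * b ^ 3) + π / (12 * b ^ 2)) with hε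
  have h₀ : 0 < (thetaArg t₀).im := by rw [thetaArg_im]; positivity
  have h₁ : 0 < (thetaArg t₀ + d).im := by rw [hwd, thetaArg_im]; positivity
  have hψ : ∀ τ ∈ Icc (0:ℝ) 1, ‖Complex.digamma (thetaArg t₀ + τ * d) -
      Complex.log (thetaArg t₀ + τ * d) + 1 / (2 * (thetaArg t₀ + τ * d))‖ ≤ ε := by
    intro τ hτ
    have him : (thetaArg t₀ + τ * d).im = (t₀ + τ * (t - t₀)) / 2 := by
      simp only [thetaArg, hd, add_im, mul_im, ofReal_re, ofReal_im, I_re, I_im]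
      norm_num; ring
    have hre : 0 < (thetaArg t₀ + τ * d).re := by
      simp only [thetaArg, hd, add_re, mul_re, ofReal_re, ofReal_im, I_re, I_im]
      norm_num
    have hbim : b ≤ (thetaArg t₀ + τ * d).im := by
      rw [him, hb]
      have h1 : min t t₀ ≤ t := min_le_left _ _
      have h2 : min t t₀ ≤ t₀ := min_le_right _ _
      have : min t t₀ ≤ t₀ + τ * (t - t₀) := by nlinarith [hτ.1, hτ.2]
      linarith
    have himpos : 0 < (thetaArg t₀ + τ * d).im := lt_of_lt_of_le hb0 hbim
    have h := norm_digamma_sub_log_add_inv_le hre himpos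
    refine h.trans ?_
    rw [hε, abs_of_pos himpos]
    gcongr
  obtain ⟨E, hE, hEq⟩ := Gamma_eq_mul_exp_stirlingPrim h₀ h₁ hψ
  refine ⟨E, hE.trans ?_, ?_⟩
  · have hnd : ‖d‖ = |t - t₀| / 2 := by
      rw [hd, norm_mul, norm_I, mul_one, norm_real, Real.norm_eq_abs, abs_div, abs_two]
    rw [hnd, UniversalFactor.lehmerSegErr]
  · rw [← hwd]; exact hEq

/-! ## The representation -/

/-- **`H_0(2t)` as the real part of `−K₀ · lehmerCore t₀ (½+it)`, up to a factor `μ ≈ 1`.** For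
`t₀ ≥ 2`, `t > 0` and `d + e ≤ π/2` (`d = lehmerPhaseErr t₀`, `e = lehmerSegErr t₀ t`): there is a real
`μ` with `e^{−e} cos(d + e) ≤ μ ≤ e^{e}` and `Re H_0(2t) · μ = −K₀ · Re lehmerCore t₀ (½ + it)`.
(Exactly: `H_0(2t) = −K₀ e^{i(θ(t₀)−φ(t₀)) + E} · lehmerCore t₀ (½+it)` with `‖E‖ ≤ e`, and `H_0(2t)`
is real.) [folklore] -/
theorem UniversalFactor.deBruijnH_zero_two_mul_repr {t₀ t : ℝ} (ht₀ : 2 ≤ t₀) (ht : 0 < t)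
    (hsmall : UniversalFactor.lehmerPhaseErr t₀ + UniversalFactor.lehmerSegErr t₀ t ≤ π / 2) :
    ∃ μ : ℝ, Real.exp (-UniversalFactor.lehmerSegErr t₀ t) *
        Real.cos (UniversalFactor.lehmerPhaseErr t₀ + UniversalFactor.lehmerSegErr t₀ t) ≤ μ ∧
      μ ≤ Real.exp (UniversalFactor.lehmerSegErr t₀ t) ∧
      (deBruijnH 0 ((2 * t : ℝ) : ℂ)).re * μ =
        -UniversalFactor.lehmerK0 t₀ * (UniversalFactor.lehmerCore t₀ (1 / 2 + t * I)).re := by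
  have ht₀0 : 0 < t₀ := by linarith
  obtain ⟨E, hE, hΓ⟩ := UniversalFactor.exists_Gamma_thetaArg_eq ht₀0 ht
  -- abbreviations (as plain names for readability of the statement below)
  have hδ : |riemannSiegelTheta t₀ - UniversalFactor.thetaMain t₀| ≤ UniversalFactor.lehmerPhaseErr t₀ := by
    rw [UniversalFactor.lehmerPhaseErr, UniversalFactor.thetaMain]
    exact abs_riemannSiegelTheta_sub_stirling_le ht₀
  set d : ℝ := UniversalFactor.lehmerPhaseErr t₀ with hd_def
  set e : ℝ := UniversalFactor.lehmerSegErr t₀ t with he_def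
  set δ : ℝ := riemannSiegelTheta t₀ - UniversalFactor.thetaMain t₀ with hδ_def
  set N : ℝ := ‖Complex.Gamma (thetaArg t₀)‖ with hN
  set r : ℂ := ((Real.exp (-Real.log π / 4) : ℝ) : ℂ) with hr
  -- the pieces
  have h1 := UniversalFactor.deBruijnH_zero_two_mul t
  have h2 := UniversalFactor.completedRiemannZeta_half t
  have h3 : Gammaℝ (1 / 2 + t * I) = r * thetaGamma (thetaArg t) := Gammaℝ_half_add_mul_I t
  have h4 : thetaGamma (thetaArg t) =
      cexp (-(thetaArg t - 1 / 4) * (Real.log π : ℂ)) * Complex.Gamma (thetaArg t) := rfl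
  have h5 : Complex.Gamma (thetaArg t₀) =
      cexp ((thetaArg t₀ - 1 / 4) * (Real.log π : ℂ)) * thetaGamma (thetaArg t₀) := by
    have h0 : (thetaArg t₀ - 1 / 4) * (Real.log π : ℂ) + -(thetaArg t₀ - 1 / 4) * (Real.log π : ℂ) = 0 := by
      ring
    rw [thetaGamma, ← mul_assoc, ← Complex.exp_add, h0, Complex.exp_zero, one_mul]
  have h6 : thetaGamma (thetaArg t₀) = (N : ℂ) * cexp (riemannSiegelTheta t₀ * I) :=
    UniversalFactor.thetaGamma_eq_norm_mul_cexp t₀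
  have h7 : ((1 : ℂ) / 2 + t * I) / 2 = thetaArg t := UniversalFactor.half_add_div_two t
  -- exponent bookkeeping
  have key : cexp (-(thetaArg t - 1 / 4) * (Real.log π : ℂ)) *
      cexp ((thetaArg t₀ - 1 / 4) * (Real.log π : ℂ)) *
      cexp (riemannSiegelTheta t₀ * I) * cexp (stirlingPrim (thetaArg t) - stirlingPrim (thetaArg t₀) + E) =
      cexp (δ * I + E) * cexp (UniversalFactor.thetaMain t₀ * I) *
        cexp (-(((1 : ℂ) / 2 + t * I - (1 / 2 + t₀ * I)) / 2) * (Real.log π : ℂ)) *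
        cexp (stirlingPrim (((1 : ℂ) / 2 + t * I) / 2) - stirlingPrim (thetaArg t₀)) := by
    rw [← Complex.exp_add, ← Complex.exp_add, ← Complex.exp_add, ← Complex.exp_add, ← Complex.exp_add,
      ← Complex.exp_add, h7]
    congr 1
    simp only [hδ_def, thetaArg]
    push_cast
    ring
  have hK : ((UniversalFactor.lehmerK0 t₀ : ℝ) : ℂ) = r * N / 16 := by
    rw [UniversalFactor.lehmerK0, hr, hN]; push_cast; ring
  have hident : deBruijnH 0 ((2 * t : ℝ) : ℂ) =
      -(UniversalFactor.lehmerK0 t₀ : ℂ) * cexp (δ * I + E) *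
        UniversalFactor.lehmerCore t₀ (1 / 2 + t * I) := by
    rw [h1, h2, h3, h4, hΓ, h5, h6, hK, UniversalFactor.lehmerCore]
    linear_combination (-(1:ℂ) / 16) * (((1 : ℂ) / 2 + t * I) * (1 - (1 / 2 + t * I))) * r * (N : ℂ) *
      riemannZeta (1 / 2 + t * I) * key
  -- realness of `H_0` on the real axis
  have him : (deBruijnH 0 ((2 * t : ℝ) : ℂ)).im = 0 := by
    rw [← deBruijnHDiv_one']; exact deBruijnHDiv_ofReal_im _ _
  have hre : deBruijnH 0 ((2 * t : ℝ) : ℂ) = ((deBruijnH 0 ((2 * t : ℝ) : ℂ)).re : ℂ) :=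
    Complex.ext (by rw [Complex.ofReal_re]) (by rw [Complex.ofReal_im, him])
  -- multiply by `ρ⁻¹ = e^{−(iδ + E)}` and take real parts
  have hK0 : (UniversalFactor.lehmerK0 t₀ : ℂ) ≠ 0 := by
    exact_mod_cast (UniversalFactor.lehmerK0_pos t₀).ne'
  have e1 : cexp (-(δ * I + E)) * deBruijnH 0 ((2 * t : ℝ) : ℂ) =
      -(UniversalFactor.lehmerK0 t₀ : ℂ) * UniversalFactor.lehmerCore t₀ (1 / 2 + t * I) := by
    rw [hident, Complex.exp_neg]
    field_simp [Complex.exp_ne_zero (δ * I + E)]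
  set μ : ℝ := Real.exp (-E.re) * Real.cos (δ + E.im) with hμ
  have hμre : (cexp (-(δ * I + E))).re = μ := by
    rw [Complex.exp_re]
    have hre' : (-(δ * I + E)).re = -E.re := by simp
    have him' : (-(δ * I + E)).im = -(δ + E.im) := by simp [add_comm]
    rw [hre', him', Real.cos_neg, hμ]
  have e2 := congrArg Complex.re e1
  rw [hre, Complex.mul_re, Complex.ofReal_re, Complex.ofReal_im, mul_zero, sub_zero, hμre,
    show -(UniversalFactor.lehmerK0 t₀ : ℂ) = ((-UniversalFactor.lehmerK0 t₀ : ℝ) : ℂ) by push_cast; ring,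
    Complex.re_ofReal_mul] at e2
  refine ⟨μ, ?_, ?_, ?_⟩
  · -- lower bound
    have hEre : |E.re| ≤ e := (Complex.abs_re_le_norm E).trans hE
    have hEim : |E.im| ≤ e := (Complex.abs_im_le_norm E).trans hE
    have hde : |δ + E.im| ≤ d + e := (abs_add_le _ _).trans (add_le_add hδ hEim)
    have hcos : Real.cos (d + e) ≤ Real.cos (δ + E.im) := by
      rw [← Real.cos_abs (δ + E.im)]
      exact Real.cos_le_cos_of_nonneg_of_le_pi (abs_nonneg _) (by linarith [Real.pi_pos]) hde
    have hcos0 : 0 ≤ Real.cos (d + e) :=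
      Real.cos_nonneg_of_mem_Icc ⟨by linarith [Real.pi_pos, abs_nonneg (δ + E.im)], hsmall⟩
    have hexp : Real.exp (-e) ≤ Real.exp (-E.re) :=
      Real.exp_le_exp.2 (by linarith [le_abs_self E.re])
    rw [hμ]
    exact mul_le_mul hexp hcos hcos0 (Real.exp_pos _).le
  · -- upper bound
    have hEre : |E.re| ≤ e := (Complex.abs_re_le_norm E).trans hE
    have hexp : Real.exp (-E.re) ≤ Real.exp e := Real.exp_le_exp.2 (by linarith [neg_abs_le E.re])
    rw [hμ]
    calc Real.exp (-E.re) * Real.cos (δ + E.im) ≤ Real.exp (-E.re) * 1 :=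
          mul_le_mul_of_nonneg_left (Real.cos_le_one _) (Real.exp_pos _).le
      _ ≤ Real.exp e := by rw [mul_one]; exact hexp
  · -- the identity
    linarith [e2]

end Summit.RiemannHypothesis.RiemannHypothesis.Theorems
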